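import Mathlib
import Summits.ValiantsHypothesis.ValiantsHypothesis.Theorems.GrenetZeonHessianRankCodimTwoBorderDeaths
import Summits.ValiantsHypothesis.ValiantsHypothesis.Theorems.GrenetZeonHessianRankCodimTwoBorderFrobeniusEval
import HarnessLib

/-!
# Crux `GrenetZeon.HessianRankCodimTwo` (stmt-ValiantsHypothesis-8061), line `good_plane`, ALL large `n`:
# the death count in the currency of the assembly — at least five `Ψ_{IJ}` survive modulo `p`

Seat val-width-8061-p3 g2; glue between `…BorderDeaths` (`bord_deaths_le_four`, BorderInterfaces.md §2) and the
assembly of BorderInterfaces.md §3 (`le_card_ne_zero_of_charP`, file `…CharPTransfer`, whose hypothesis `hchar` asks: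
over every field `L` of characteristic `p`, at every `w ≠ 0` with `Φ(w) = 0`, at least `N = 5` of the
`Ψ_{IJ}(w) = aeval w (bordPsi ℤ p r I J)` are non-zero).

* `natCast_ne_zero_of_lt_of_charP` — in characteristic `p ≥ B`, every `0 < m < B` is non-zero in `L` (the
  arithmetic hypothesis `hK` of the certificate API, `B = 3·10¹⁴`);
* `bord_five_le_card_aeval_bordPsi_ne_zero` — for `L` of characteristic `p` (prime, `1 ≤ r`, `r + 2 ≤ p`),
  under the field-level hypotheses (HW), (HC), (HT) of BorderInterfaces.md §1 for `L`: at every `w ≠ 0` with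
  `aeval w (bordPhi ℤ p r) = 0`, at least five of the nine `aeval w (bordPsi ℤ p r I J)` are non-zero.
  Proof: the curve and death criteria mod `p` of the lead's `…BorderFrobeniusEval`
  (`curve_of_aeval_bordPhi_eq_zero`, `dead_of_aeval_bordPsi_eq_zero`, with `c = r + 1 ≠ 0` in `L` as
  `r + 1 < p`) put the vanishing `Ψ`'s inside the dead set of `bord_deaths_le_four`, which has at most four
  elements; `9 - 4 = 5`.

So the assembly's `hchar` is `fun L _ _ _ w hw hΦ => bord_five_le_card_aeval_bordPsi_ne_zero … (certs for L) w hw hΦ`.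
VP ≠ VNP is not moved by anything here.
-/

noncomputable section

open MvPolynomial Finset

-- single-conjunct layout `Summits/ValiantsHypothesis/ValiantsHypothesis`: duplicated namespace by design
set_option linter.dupNamespace false

namespace Summit.ValiantsHypothesis.ValiantsHypothesis.Theorems.GrenetZeonHessianRankCodimTwo

/-- In characteristic `p ≥ B` the naturals `0 < m < B` are non-zero (the hypothesis `hK` of the certificate
API). [folklore] -/
theorem natCast_ne_zero_of_lt_of_charP (L : Type*) [AddMonoidWithOne L] (p : ℕ) [CharP L p] {B : ℕ}
    (hB : B ≤ p) : ∀ m : ℕ, 0 < m → m < B → (m : L) ≠ 0 := by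
  intro m hm hmB h
  have hdvd : p ∣ m := (CharP.cast_eq_zero_iff L p m).mp h
  have := Nat.le_of_dvd hm hdvd
  omega

section CharP

variable {L : Type*} [Field L] [DecidableEq L] (p : ℕ) [hp : Fact p.Prime] [CharP L p]

/-- **At least five of the nine `Ψ_{IJ}` survive modulo `p`.**  For a field `L` of characteristic `p`,
`1 ≤ r`, `r + 2 ≤ p`, under the hypotheses (HW), (HC), (HT) of BorderInterfaces.md §1 for `L` (and its
arithmetic hypothesis `hK`): at every `w ≠ 0` with `aeval w (bordPhi ℤ p r) = 0`, at least five of the values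
`aeval w (bordPsi ℤ p r I J)` are non-zero — the hypothesis `hchar` (with `N = 5`) of `le_card_ne_zero_of_charP`.
[folklore] -/
theorem bord_five_le_card_aeval_bordPsi_ne_zero {r : ℕ} (hr1 : 1 ≤ r) (hrp : r + 2 ≤ p)
    (hK : ∀ m : ℕ, 0 < m → m < 300000000000000 → (m : L) ≠ 0)
    (HW₁ : ∀ x : Fin 3 → L, x ≠ 0 → aeval x (bordEnt ℤ none none) = 0 → ∀ {d d' : Fin 3},
      (x d = 0 ∨ x d ^ 2 + x (d + 1) * x (d + 2) = 0) →
      (x d' = 0 ∨ x d' ^ 2 + x (d' + 1) * x (d' + 2) = 0) → d = d')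
    (HW₂ : ∀ x : Fin 3 → L, x ≠ 0 → aeval x (bordEnt ℤ none none) = 0 → ∀ {d I : Fin 3},
      (x d = 0 ∨ x d ^ 2 + x (d + 1) * x (d + 2) = 0) → aeval x (bordEnt ℤ (some I) none) = 0 → False)
    (HW₃ : ∀ x : Fin 3 → L, x ≠ 0 → aeval x (bordEnt ℤ none none) = 0 → ∀ {d J : Fin 3},
      (x d = 0 ∨ x d ^ 2 + x (d + 1) * x (d + 2) = 0) → aeval x (bordEnt ℤ none (some J)) = 0 → False)
    (HW₄ : ∀ x : Fin 3 → L, x ≠ 0 → aeval x (bordEnt ℤ none none) = 0 → ∀ {I I' : Fin 3},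
      aeval x (bordEnt ℤ (some I) none) = 0 → aeval x (bordEnt ℤ (some I') none) = 0 → I = I')
    (HW₅ : ∀ x : Fin 3 → L, x ≠ 0 → aeval x (bordEnt ℤ none none) = 0 → ∀ {J J' : Fin 3},
      aeval x (bordEnt ℤ none (some J)) = 0 → aeval x (bordEnt ℤ none (some J')) = 0 → J = J')
    (HW₆ : ∀ x : Fin 3 → L, x ≠ 0 → aeval x (bordEnt ℤ none none) = 0 → ∀ {I J : Fin 3},
      aeval x (bordEnt ℤ (some I) none) = 0 → aeval x (bordEnt ℤ none (some J)) = 0 → False)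
    (HCQ : ∀ x : Fin 3 → L, x ≠ 0 → x 0 ^ 3 + x 1 ^ 3 + x 2 ^ 3 + 3 * (x 0 * x 1 * x 2) = 0 →
      ∀ {d₀ : Fin 3}, (x d₀ = 0 ∨ x d₀ ^ 2 + x (d₀ + 1) * x (d₀ + 2) = 0) → ∀ {I J : Fin 3}, J - I ≠ d₀ →
      x (J - I) * aeval x (bordEnt ℤ none none) ≠
        aeval x (bordEnt ℤ (some I) none) * aeval x (bordEnt ℤ none (some J)))
    (HCE : ∀ x : Fin 3 → L, x ≠ 0 → x 0 ^ 3 + x 1 ^ 3 + x 2 ^ 3 + 3 * (x 0 * x 1 * x 2) = 0 →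
      ∀ {d₀ : Fin 3}, (x d₀ = 0 ∨ x d₀ ^ 2 + x (d₀ + 1) * x (d₀ + 2) = 0) → ∀ {I J I' J' : Fin 3},
      J - I ≠ d₀ → J' - I' ≠ d₀ → (I, J) ≠ (I', J') →
      aeval x (bordEnt ℤ (some I) none) * aeval x (bordEnt ℤ none (some J)) ≠ 0 →
      aeval x (bordEnt ℤ (some I') none) * aeval x (bordEnt ℤ none (some J')) ≠ 0 →
      x (J - I) ≠ 0 → x (J' - I') ≠ 0 →
      x (J - I) * (aeval x (bordEnt ℤ (some I') none) * aeval x (bordEnt ℤ none (some J'))) ≠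
        x (J' - I') * (aeval x (bordEnt ℤ (some I) none) * aeval x (bordEnt ℤ none (some J))))
    (HT : ∀ x : Fin 3 → L, x ≠ 0 → x 0 ^ 3 + x 1 ^ 3 + x 2 ^ 3 + 3 * (x 0 * x 1 * x 2) = 0 →
      aeval x (bordEnt ℤ none none) ≠ 0 → (∀ d, x d ≠ 0) →
      ∀ {I₁ J₁ I₂ J₂ I₃ J₃ : Fin 3}, (I₁, J₁) ≠ (I₂, J₂) → (I₁, J₁) ≠ (I₃, J₃) → (I₂, J₂) ≠ (I₃, J₃) →
      aeval x (bordEnt ℤ (some I₁) none) * aeval x (bordEnt ℤ none (some J₁)) ≠ 0 →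
      aeval x (bordEnt ℤ (some I₂) none) * aeval x (bordEnt ℤ none (some J₂)) ≠ 0 →
      aeval x (bordEnt ℤ (some I₃) none) * aeval x (bordEnt ℤ none (some J₃)) ≠ 0 →
      x (J₁ - I₁) * (aeval x (bordEnt ℤ (some I₂) none) * aeval x (bordEnt ℤ none (some J₂))) =
        x (J₂ - I₂) * (aeval x (bordEnt ℤ (some I₁) none) * aeval x (bordEnt ℤ none (some J₁))) →
      x (J₁ - I₁) * (aeval x (bordEnt ℤ (some I₃) none) * aeval x (bordEnt ℤ none (some J₃))) =
        x (J₃ - I₃) * (aeval x (bordEnt ℤ (some I₁) none) * aeval x (bordEnt ℤ none (some J₁))) →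
      False)
    (w : Fin 3 → L) (hw : w ≠ 0) (hΦ : aeval w (bordPhi ℤ p r) = 0) :
    5 ≤ #(univ.filter fun IJ : Fin 3 × Fin 3 => aeval w (bordPsi ℤ p r IJ.1 IJ.2) ≠ 0) := by
  -- `c = r + 1 ≠ 0` in `L` (`r + 1 < p`)
  have hc : ((r + 1 : ℕ) : L) ≠ 0 := by
    intro h
    have hdvd : p ∣ r + 1 := (CharP.cast_eq_zero_iff L p (r + 1)).mp h
    have := Nat.le_of_dvd (Nat.succ_pos r) hdvd
    omega
  -- the point is on the curve `F = 0 ∨ W = 0`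
  have hcurve : w 0 ^ 3 + w 1 ^ 3 + w 2 ^ 3 + 3 * (w 0 * w 1 * w 2) = 0 ∨
      aeval w (bordEnt ℤ none none) = 0 := by
    rcases curve_of_aeval_bordPhi_eq_zero p (by omega) w hΦ with h | h
    · exact Or.inl h
    · exact Or.inr (by rw [aeval_bordEnt_w]; exact h)
  have h4 := bord_deaths_le_four hK HW₁ HW₂ HW₃ HW₄ HW₅ HW₆ HCQ HCE HT ((r + 1 : ℕ) : L) hc w hw hcurve
  -- the vanishing `Ψ`'s are dead pairs
  have hsub : (univ.filter fun IJ : Fin 3 × Fin 3 => ¬ (aeval w (bordPsi ℤ p r IJ.1 IJ.2) ≠ 0)) ⊆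
      univ.filter fun IJ : Fin 3 × Fin 3 =>
        (w (IJ.2 - IJ.1) = 0 ∨ w (IJ.2 - IJ.1) ^ 2 + w (IJ.2 - IJ.1 + 1) * w (IJ.2 - IJ.1 + 2) = 0) ∨
        w (IJ.2 - IJ.1) * aeval w (bordEnt ℤ none none) =
          aeval w (bordEnt ℤ (some IJ.1) none) * aeval w (bordEnt ℤ none (some IJ.2)) ∨
        w (IJ.2 - IJ.1) * aeval w (bordEnt ℤ none none) =
          ((r + 1 : ℕ) : L) *
            (aeval w (bordEnt ℤ (some IJ.1) none) * aeval w (bordEnt ℤ none (some IJ.2))) := by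
    intro IJ hIJ
    rw [Finset.mem_filter] at hIJ ⊢
    refine ⟨Finset.mem_univ _, ?_⟩
    have h0 : aeval w (bordPsi ℤ p r IJ.1 IJ.2) = 0 := not_not.mp hIJ.2
    rcases dead_of_aeval_bordPsi_eq_zero p hr1 hrp w IJ.1 IJ.2 h0 with h | h | h | h
    · exact Or.inl (Or.inr h)
    · exact Or.inl (Or.inl h)
    · exact Or.inr (Or.inl h)
    · exact Or.inr (Or.inr h)
  have hle := (Finset.card_le_card hsub).trans h4
  have hsplit := Finset.card_filter_add_card_filter_not
    (s := (Finset.univ : Finset (Fin 3 × Fin 3)))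
    (fun IJ : Fin 3 × Fin 3 => aeval w (bordPsi ℤ p r IJ.1 IJ.2) ≠ 0)
  have h9 : #(Finset.univ : Finset (Fin 3 × Fin 3)) = 9 := by simp
  omega

end CharP

end Summit.ValiantsHypothesis.ValiantsHypothesis.Theorems.GrenetZeonHessianRankCodimTwo
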